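import Summits.CriticalPhenomena.PercolationContinuityZ3.Theorems.PercNearOneGluingNoHeavyQuantFarSupportCert
import Summits.CriticalPhenomena.PercolationContinuityZ3.Theorems.PercNearOneGluingNoHeavyLowerTailTwoCopyFastCheck
import HarnessLib

/-!
# FAR (`Quant.FarRelayRow`) on SUN GRAPHS: exact two-copy certificates for the cycle `C_{K+1}` through the observer with one
# pendant relay per cycle vertex — the canonical instances behind FAR on ALL hairy cycles; here `K = 3, 4` (and the plumbing),
# `K = 5` in `…QuantFarSunCertFive` / `…FiveTwo`

builds on p205010 (kernel theorem, internal audit signed; external expert review pending)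

Support file (`--supports stmt-CriticalPhenomena-4575`), seat `prim-cert-1` (gen 18); QUANT lane rung R8, front "FAR beyond trees" (lead g20,
2026-08-21: `Quant.FarRelayRow` on supports with a cycle; first family = rings with pendant relays).  COMPUTATIONAL: the `_check`
(via the fast checker `TwoCopy.twoCopyCheckFast` = `twoCopyCheck`, `…TwoCopyFastCheck`), `_tArr_eq`, `_hArr_eq`, `_pos` theorems use `native_decide`.

The SUN GRAPH `sun K` is the cycle `0 – 1 – ⋯ – K – 0` through the observer `0` with a pendant edge ("hair") `(i, K + i)` at every
other cycle vertex; the relays are the tips `K+1, …, 2K`.  SEGMENT REDUCTION (memo `prim-cert-1/FROM-prim-cert-1-g18-FAR-UNICYCLIC.md`):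
on ANY cycle of ANY length through the observer with pendant relays (several per vertex, at the observer, on pendant paths, or relays
ON the cycle), the joint law of the indicators `1[o ↔ x]` (`x` a relay) depends only on the products of the cycle weights between
consecutive relay positions and on the hair weights — i.e. it IS the law of a sun graph `sun K` with those products as cycle weights
(weight `1` = adjacent positions / relay on the cycle, weight `0` = cut).  Hence FAR at `(K, j)` for every hairy cycle is FAR on `sun K`,
and a two-copy certificate on the `2K + 1` coordinates of `sun K` (support-restricted soundness `TwoCopy.FARp.of_check_on`,
`…QuantFarSupportCert`) settles the whole family at once.  This file lands the certificates (exact rational, RELAY-SET-LEVEL: the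
multipliers `a_i(c), b(c)` depend on the ghost configuration `c` only through the set `R(c)` of tips joined to `0`, `(K+1)·2^K` numbers):

* generic plumbing: `relMask` (the index mask `R(c)`), memoised tables `tArrOf` / `hArrOf` / `aArrOf` / `bArrOf` and their lookups
  `getA2` / `getA2N` (so that `twoCopyCheck` runs on array lookups; the agreement with `TwoCopy.tF` / `TwoCopy.hF` is itself decided);
* `farp_sun3_j1` (`K = 3`, layer `1`, denominator 2, 11 nonzero multipliers), `farp_sun4_j1` (`K = 4`, layer `1`) — and in the sequel files
  `farp_sun5_j1`, `farp_sun5_j2` (`K = 5`, layers `1, 2`, ≈130 s each): **`TwoCopy.FARp w (tips) 0 j` for EVERY weight function `w` on `Fin (2K+1)` vanishing off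
  the sun graph** — `2j < Σ_v P(0 ↔ v)` and `P(0 ↮ v) ≤ t` on the tips imply `P(#{tips joined to 0} ≤ j) ≤ t`.  (`K ≤ 2` and `2j ≥ K`
  are vacuous, `TwoCopy.FARp.of_card_le`; so these are ALL layers for `K ≤ 5`.)
Certificates: kit bigcert (prim-cert-1 g18; C row builder + HiGHS + exact active-set reconstruction), jobs j135554 (layers 1) and j135536
(`K = 5`, layer 2); census behind the choice of family: every FAR instance on every unicyclic support with `≤ 7` vertices has such a
certificate (6742 instances, kit j135186).
[cite: KozmaNitzan2024, Lemma 2 (p. 6), Conjecture 3 (p. 15)] (context: the lower-tail family; FAR is this programme's statement).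
-/

namespace Summit.CriticalPhenomena.PercolationContinuityZ3.Theorems.TwoCopy

open Finset MeasureTheory
open Literature.Probability.Percolation Literature.Probability.LatticeModels
open Summit.CriticalPhenomena.PercolationContinuityZ3.Theorems.AdditiveGluing.Negative.Cert

/-! ## Relay-set-level certificates: plumbing (one reach computation per configuration) -/

/-- The cluster mask of the observer: bit `v` set iff `o ↔ v` in the configuration `c` of `es`. [this work] -/
def compOf (n : ℕ) (es : List (Fin n × Fin n)) (o : Fin n) (c : ℕ) : ℕ := (reachTable n (pick es c)).getD (o : ℕ) 0

/-- All cluster masks, `c < 2^m` (computed once). [this work] -/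
def compArrOf (n : ℕ) (es : List (Fin n × Fin n)) (o : Fin n) : Array ℕ :=
  ((List.range (2 ^ es.length)).map (compOf n es o)).toArray

/-- Target entry `1[o ↮ v_i] − 1[N ≤ j]` read off a cluster mask. [this work] -/
def tOfComp {n : ℕ} (As : List (Fin n)) (o : Fin n) (j i : ℕ) (C : ℕ) : ℤ :=
  (if C.testBit ((As.getD i o : Fin n) : ℕ) then 0 else 1) -
    (if (As.filter fun a : Fin n => C.testBit (a : ℕ)).length ≤ j then 1 else 0)

/-- Hypothesis entry `N − 2j` read off a cluster mask. [this work] -/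
def hOfComp {n : ℕ} (As : List (Fin n)) (j : ℕ) (C : ℕ) : ℤ :=
  ((As.filter fun a : Fin n => C.testBit (a : ℕ)).length : ℤ) - 2 * j

/-- The relay-index mask `R` read off a cluster mask: bit `i` set iff the `i`-th listed relay is in the cluster. [this work] -/
def rOfComp {n : ℕ} (As : List (Fin n)) (o : Fin n) (C : ℕ) : ℕ :=
  (List.range As.length).foldl (fun acc i => if C.testBit ((As.getD i o : Fin n) : ℕ) then acc ||| (1 <<< i) else acc) 0

/-- `tF` is `tOfComp` of the cluster mask. [this work] -/
theorem tF_eq_tOfComp {n : ℕ} (es : List (Fin n × Fin n)) (As : List (Fin n)) (o : Fin n) (j i c : ℕ) :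
    tF n es As o j i c = tOfComp As o j i (compOf n es o c) := rfl

/-- `hF` is `hOfComp` of the cluster mask. [this work] -/
theorem hF_eq_hOfComp {n : ℕ} (es : List (Fin n × Fin n)) (As : List (Fin n)) (o : Fin n) (j c : ℕ) :
    hF n es As o j c = hOfComp As j (compOf n es o c) := rfl

/-- Lookup in a mapped range. [folklore] -/
theorem getD_toArray_map_range {α : Type*} (f : ℕ → α) (N c : ℕ) (d : α) (hc : c < N) :
    ((List.range N).map f).toArray.getD c d = f c := by
  have hsz : c < ((List.range N).map f).toArray.size := by simpa using hc
  rw [Array.getD_eq_getD_getElem?, Array.getElem?_eq_getElem hsz, Option.getD_some]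
  simp

/-- The memoised cluster masks are the cluster masks. [this work] -/
theorem compArrOf_getD {n : ℕ} (es : List (Fin n × Fin n)) (o : Fin n) {c : ℕ} (hc : c < 2 ^ es.length) :
    (compArrOf n es o).getD c 0 = compOf n es o c :=
  getD_toArray_map_range _ _ _ _ hc

/-- Lookup in a two-level natural list table (junk `0`). [this work] -/
def tab2 (tab : List (List ℕ)) (i R : ℕ) : ℕ := (tab.getD i []).getD R 0

/-! ## The certificates -/
/-- The sun graph `C_4` with one hair per non-observer vertex, `K = 3`: observer `0`, bases `1..3`, tips `4..6`;
edge `i` of the list = cycle edges `(i, i+1 mod 4)` then the hairs `(i, 3+i)`. [this work] -/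
def sun3_es : List (Fin 7 × Fin 7) := [(0, 1), (1, 2), (2, 3), (3, 0), (1, 4), (2, 5), (3, 6)]

/-- The relays of `sun3`: the hair tips in cyclic order. [this work] -/
def sun3_As : List (Fin 7) := [4, 5, 6]

/-- `sun3_es` has distinct unordered pairs. [this work] -/
theorem sun3_nodup : (sun3_es.map mkE).Nodup := by native_decide

/-- `sun3_As` has no duplicates. [this work] -/
theorem sun3_As_nodup : sun3_As.Nodup := by decide

/-- Memoised cluster masks of the observer `0`, one per configuration (COMPUTED once). [this work] -/
def sun3_comp : Array ℕ := compArrOf 7 sun3_es 0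


/-- Relay-set-level multiplier table `a_i(R)` (numerators, common denominator 2) of the exact two-copy certificate for
FAR on `sun3` at layer `1` (11 nonzero entries; kit bigcert, verified exactly over all `3^7` fibres in the job and re-checked
here). [this work] -/
def sun3_j1_aTab : List (List ℕ) := [[0, 0, 1, 2, 0, 0, 0, 0], [2, 0, 1, 1, 0, 1, 1, 1], [0, 2, 1, 0, 0, 0, 0, 0]]

/-- Multiplier table `b(R)` of the same certificate. [this work] -/
def sun3_j1_bTab : List ℕ := [0, 0, 1, 0, 0, 0, 0, 0]

/-- THE CHECK: every fibre coefficient of the certificate is nonnegative (COMPUTATIONAL: `native_decide` on the fast checker,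
tables read off the memoised cluster masks `sun3_comp`). [this work] -/
theorem sun3_j1_check : twoCopyCheck sun3_es.length 3 (fun i c => tOfComp sun3_As 0 1 i (sun3_comp.getD c 0))
    (fun c => hOfComp sun3_As 1 (sun3_comp.getD c 0))
    (fun i c => tab2 sun3_j1_aTab i (rOfComp sun3_As 0 (sun3_comp.getD c 0)))
    (fun c => sun3_j1_bTab.getD (rOfComp sun3_As 0 (sun3_comp.getD c 0)) 0) = true := by
  rw [← twoCopyCheckFast_eq]; native_decide

/-- A positive multiplier entry. [this work] -/
theorem sun3_j1_pos : 0 < tab2 sun3_j1_aTab 1 (rOfComp sun3_As 0 (sun3_comp.getD 0 0)) := by native_decide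

/-- **FAR at layer `1` on the sun graph `sun3` for EVERY weight function vanishing off it** (all sub-supports included):
`2·1 < Σ_v P(0 ↔ v)` and `P(0 ↮ v) ≤ t` on the tips imply `P(#{tips joined to 0} ≤ 1) ≤ t`. [this work] -/
theorem farp_sun3_j1 (w : Sym2 (Fin 7) → unitInterval) (hw : VanishesOff w sun3_es) : FARp w sun3_As.toFinset 0 1 :=
  FARp.of_check_on sun3_es sun3_nodup sun3_As_nodup 0 1 (K := 3) (by decide)
    (fun i _ c hc => by unfold sun3_comp; rw [tF_eq_tOfComp, compArrOf_getD _ _ hc])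
    (fun c hc => by unfold sun3_comp; rw [hF_eq_hOfComp, compArrOf_getD _ _ hc]) sun3_j1_check
    (i₀ := 1) (c₀ := 0) (by decide) (by decide) sun3_j1_pos w hw


/-- The sun graph `C_5` with one hair per non-observer vertex, `K = 4`: observer `0`, bases `1..4`, tips `5..8`;
edge `i` of the list = cycle edges `(i, i+1 mod 5)` then the hairs `(i, 4+i)`. [this work] -/
def sun4_es : List (Fin 9 × Fin 9) := [(0, 1), (1, 2), (2, 3), (3, 4), (4, 0), (1, 5), (2, 6), (3, 7), (4, 8)]

/-- The relays of `sun4`: the hair tips in cyclic order. [this work] -/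
def sun4_As : List (Fin 9) := [5, 6, 7, 8]

/-- `sun4_es` has distinct unordered pairs. [this work] -/
theorem sun4_nodup : (sun4_es.map mkE).Nodup := by native_decide

/-- `sun4_As` has no duplicates. [this work] -/
theorem sun4_As_nodup : sun4_As.Nodup := by decide

/-- Memoised cluster masks of the observer `0`, one per configuration (COMPUTED once). [this work] -/
def sun4_comp : Array ℕ := compArrOf 9 sun4_es 0


/-- Relay-set-level multiplier table `a_i(R)` (numerators, common denominator 8) of the exact two-copy certificate for
FAR on `sun4` at layer `1` (37 nonzero entries; kit bigcert, verified exactly over all `3^9` fibres in the job and re-checked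
here). [this work] -/
def sun4_j1_aTab : List (List ℕ) := [[0, 0, 2, 3, 0, 2, 2, 2, 0, 1, 0, 1, 0, 0, 0, 0], [0, 0, 0, 1, 0, 2, 2, 6, 2, 2, 3, 7, 0, 6, 2, 8], [2, 1, 1, 0, 1, 1, 1, 0, 0, 3, 3, 6, 0, 5, 5, 8], [0, 2, 0, 2, 1, 0, 0, 0, 0, 2, 0, 0, 2, 2, 0, 0]]

/-- Multiplier table `b(R)` of the same certificate. [this work] -/
def sun4_j1_bTab : List ℕ := [0, 0, 0, 0, 1, 0, 0, 0, 0, 0, 0, 0, 0, 0, 0, 0]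

/-- THE CHECK: every fibre coefficient of the certificate is nonnegative (COMPUTATIONAL: `native_decide` on the fast checker,
tables read off the memoised cluster masks `sun4_comp`). [this work] -/
theorem sun4_j1_check : twoCopyCheck sun4_es.length 4 (fun i c => tOfComp sun4_As 0 1 i (sun4_comp.getD c 0))
    (fun c => hOfComp sun4_As 1 (sun4_comp.getD c 0))
    (fun i c => tab2 sun4_j1_aTab i (rOfComp sun4_As 0 (sun4_comp.getD c 0)))
    (fun c => sun4_j1_bTab.getD (rOfComp sun4_As 0 (sun4_comp.getD c 0)) 0) = true := by
  rw [← twoCopyCheckFast_eq]; native_decide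

/-- A positive multiplier entry. [this work] -/
theorem sun4_j1_pos : 0 < tab2 sun4_j1_aTab 2 (rOfComp sun4_As 0 (sun4_comp.getD 0 0)) := by native_decide

/-- **FAR at layer `1` on the sun graph `sun4` for EVERY weight function vanishing off it** (all sub-supports included):
`2·1 < Σ_v P(0 ↔ v)` and `P(0 ↮ v) ≤ t` on the tips imply `P(#{tips joined to 0} ≤ 1) ≤ t`. [this work] -/
theorem farp_sun4_j1 (w : Sym2 (Fin 9) → unitInterval) (hw : VanishesOff w sun4_es) : FARp w sun4_As.toFinset 0 1 :=
  FARp.of_check_on sun4_es sun4_nodup sun4_As_nodup 0 1 (K := 4) (by decide)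
    (fun i _ c hc => by unfold sun4_comp; rw [tF_eq_tOfComp, compArrOf_getD _ _ hc])
    (fun c hc => by unfold sun4_comp; rw [hF_eq_hOfComp, compArrOf_getD _ _ hc]) sun4_j1_check
    (i₀ := 2) (c₀ := 0) (by decide) (by decide) sun4_j1_pos w hw

end Summit.CriticalPhenomena.PercolationContinuityZ3.Theorems.TwoCopy
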